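import Summits.QuantumFields.YangMills.Theorems.UnitScaleTiltProp7BCHRemainderLipschitz
import Summits.QuantumFields.YangMills.Theorems.UnitScaleTiltProp7ExpFieldRows
import Summits.QuantumFields.YangMills.Theorems.UnitScaleTiltProp7ConjCoeffRows
import Literature.MathematicalPhysics.QuantumFieldTheory.Balaban1983to89.MatrixLogLipschitz
import HarnessLib

/-!
# Prop 7, route-R E′, (E1-c) brick F4e — THE `P₃ = log(PQ) − log P − log Q` PIECE: IT IS THE BCH REMAINDER `bch(uBu*, log Q)`, AND ITS BOND LIPSCHITZ ROW IN `(u, Q)`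

Route `UnitScaleTilt`, crux K1 child «MinimiserStabilityRegPr» (`stmt-QuantumFields-19200`), cell ym3-torus, width seat px15 (gen 2); pen «px15 g2: (E1-c) GO-LOCATE» (★p1 g15,
2026-08-28T20:45:05Z), LOCATE `LOCATE-E1C-DIVLIPSCHITZ-px15g2.md` §6 (F4: `P₃` of F2 ✓p668882's trisection is CRUDE — two `ℓ⁻¹`-small data).  THEOREMS ONLY (0 `def`, 0 `sorry`);
`--supports stmt-QuantumFields-19200`, count-neutral.  YM₃ on T³ is a ladder rung (R3), not the Clay problem; nothing here claims the stub, the crux, d = 4 or the mass gap.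

WHAT (any complete normed `ℂ`-*-algebra `E` with `‖1‖ = 1`, `‖a*‖ = ‖a‖`).  With `P = uEu*` (`E = e^B`, `B = log E` the DATA chart, `u` unitary) and `Q` the pure-gauge product (`‖Q − 1‖ < 1`):
* `exp_conj_unitary` (`e^{uBu*} = u e^B u*`), ★ `chartP₃_eq_bch` (`log(PQ) − uBu* − log Q = bch(uBu*, log Q)`, `bch(X,Y) := log(e^Xe^Y) − X − Y`);
* `norm_conj_le'` (`‖uBu*‖ ≤ ‖B‖` for `‖u‖ ≤ 1`), ★ `norm_mlog_sub_mlog_le` (`log` is `(1−r)⁻¹`-Lipschitz on `‖· − 1‖ ≤ r < 1`, from ✓ `MatrixLogLipschitz`),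
  `gaugeProduct_sub_one` (`Q := u·(u + D)* = 1 + uD*` for `uu* = 1`: `‖Q − 1‖ ≤ ‖D‖`, and `‖Q − Q′‖ ≤ ‖u − u′‖‖D‖ + ‖D − D′‖`);
* ★★★ `norm_bchPiece_sub_le`: for `‖u‖,‖u′‖ ≤ 1`, `‖B‖ ≤ β ≤ 1∕40`, `‖Y‖,‖Y′‖ ≤ m_Y ≤ 1∕40`:
  `‖bch(uBu*, Y) − bch(u′Bu′*, Y′)‖ ≤ 8·m_Y·β·‖u − u′‖ + 4·β·‖Y − Y′‖` (✓p656480-family `norm_bch_sub_bch_le_of_norm_le` + F4d(i) `κ = 2`).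
With `Y = log Q`, `‖Y − Y′‖ ≤ (1−r)⁻¹(‖u−u′‖δᵘ + δᵘ_d)` and the crude rule (✓p673053 `norm_divB_le_sum'`) this is the `P₃` part of `hN`: every term is `β × (u-rows)`, `ℓβ ≤ ‖D‴‖_Y`.
HONEST SCOPE.  Assembly ([folklore]).

References: T. Bałaban, CMP 98 (1985) 17–51 [Balaban1985Averaging] ((19)–(21) p.21, (26) p.22); [folklore].
-/

set_option autoImplicit false

noncomputable section

open NormedSpace

namespace Summit.QuantumFields.YangMills.Theorems.Prop7BCHPieceRows

open Literature.MathematicalPhysics.QuantumFieldTheory.Balaban1983to89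
open MatrixLog (mlog mlog_def exp_mlog norm_mlog_le_two_mul)
open MatrixLogLipschitz (norm_logOnePlus_sub_logOnePlus_le)
open B9Eq39Adjoint (R)
open Summit.QuantumFields.YangMills.Theorems.Prop7BCHRemainderLipschitz (norm_bch_sub_bch_le_of_norm_le)
open Summit.QuantumFields.YangMills.Theorems.Prop7ExpFieldRows (R_exp)
open Summit.QuantumFields.YangMills.Theorems.Prop7ConjCoeffRows (norm_conjCoeff_sub_le)

variable {E : Type*} [NormedRing E] [NormedAlgebra ℂ E] [CompleteSpace E] [StarRing E] [NormedStarGroup E]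

/-! ## §1 Identification -/

omit [NormedStarGroup E] in
/-- `e^{uBu*} = u·e^B·u*` for `u*u = uu* = 1`. [folklore] -/
theorem exp_conj_unitary {u : E} (hu : star u * u = 1) (hu' : u * star u = 1) (B : E) :
    exp (u * B * star u) = u * exp B * star u := by
  have h := R_exp (⟨u, star u, hu', hu⟩ : Eˣ) B
  simp only [R] at h
  exact h.symm

omit [NormedStarGroup E] in
/-- ★ **`P₃` IS A BCH REMAINDER**: with `E = e^B` written as `‖E − 1‖ < 1`, `B := log E`, `u` unitary and `‖Q − 1‖ < 1`,
`log((uEu*)·Q) − u(log E)u* − log Q = bch(u(log E)u*, log Q)`. [cite: Balaban1985Averaging, (19)-(21) p.21] -/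
theorem chartP₃_eq_bch {u En Q : E} (hu : star u * u = 1) (hu' : u * star u = 1) (hE : ‖En - 1‖ < 1) (hQ : ‖Q - 1‖ < 1) :
    mlog ((u * En * star u) * Q) - u * mlog En * star u - mlog Q
      = mlog (exp (u * mlog En * star u) * exp (mlog Q)) - u * mlog En * star u - mlog Q := by
  rw [exp_conj_unitary hu hu', exp_mlog hE, exp_mlog hQ]

/-! ## §2 Rows -/

omit [NormedAlgebra ℂ E] [CompleteSpace E] in
/-- `‖uBu*‖ ≤ ‖B‖` for `‖u‖ ≤ 1`. [folklore] -/
theorem norm_conj_le' {u : E} (hu : ‖u‖ ≤ 1) (B : E) : ‖u * B * star u‖ ≤ ‖B‖ := by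
  have h0 : 0 ≤ ‖B‖ := norm_nonneg _
  calc ‖u * B * star u‖ ≤ ‖u‖ * ‖B‖ * ‖star u‖ := (norm_mul_le _ _).trans (mul_le_mul_of_nonneg_right (norm_mul_le _ _) (norm_nonneg _))
    _ ≤ 1 * ‖B‖ * 1 := by
        rw [norm_star]
        exact mul_le_mul (mul_le_mul_of_nonneg_right hu h0) hu (norm_nonneg _) (by positivity)
    _ = ‖B‖ := by ring

omit [StarRing E] [NormedStarGroup E] in
/-- ★ `log` is `(1−r)⁻¹`-Lipschitz on `‖· − 1‖ ≤ r < 1`. [cite: Balaban1985Averaging, (26) p.22] -/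
theorem norm_mlog_sub_mlog_le {Q Q' : E} {r : ℝ} (hr : r < 1) (hQ : ‖Q - 1‖ ≤ r) (hQ' : ‖Q' - 1‖ ≤ r) :
    ‖mlog Q - mlog Q'‖ ≤ ‖Q - Q'‖ / (1 - r) := by
  rw [mlog_def, mlog_def]
  have h := norm_logOnePlus_sub_logOnePlus_le hr hQ hQ'
  rwa [sub_sub_sub_cancel_right] at h

omit [NormedAlgebra ℂ E] [CompleteSpace E] [NormedStarGroup E] in
/-- The pure-gauge product in `u`-letters: for `uu* = 1`, `u·(u + D)* = 1 + u·D*`; hence `‖Q − 1‖ ≤ ‖D‖` (`‖u‖ ≤ 1`). [folklore] -/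
theorem gaugeProduct_sub_one {u : E} (hu' : u * star u = 1) (D : E) : u * star (u + D) - 1 = u * star D := by
  rw [star_add, mul_add, hu']; abel

omit [NormedAlgebra ℂ E] [CompleteSpace E] in
/-- `‖u·D*‖ ≤ ‖D‖` and the Lipschitz row `‖uD* − u′D′*‖ ≤ ‖u − u′‖‖D‖ + ‖D − D′‖` for `‖u‖,‖u′‖ ≤ 1`. [folklore] -/
theorem norm_gaugeProduct_sub_le {u u' : E} (hu : ‖u‖ ≤ 1) (hu' : ‖u'‖ ≤ 1) (D D' : E) :
    ‖u * star D‖ ≤ ‖D‖ ∧ ‖u * star D - u' * star D'‖ ≤ ‖u - u'‖ * ‖D‖ + ‖D - D'‖ := by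
  refine ⟨(norm_mul_le _ _).trans (by rw [norm_star]; exact (mul_le_mul_of_nonneg_right hu (norm_nonneg _)).trans (by rw [one_mul])), ?_⟩
  have e : u * star D - u' * star D' = (u - u') * star D + u' * star (D - D') := by rw [star_sub]; noncomm_ring
  rw [e]
  calc ‖(u - u') * star D + u' * star (D - D')‖ ≤ ‖u - u'‖ * ‖star D‖ + ‖u'‖ * ‖star (D - D')‖ :=
        (norm_add_le _ _).trans (add_le_add (norm_mul_le _ _) (norm_mul_le _ _))
    _ ≤ ‖u - u'‖ * ‖D‖ + 1 * ‖D - D'‖ := by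
        rw [norm_star, norm_star]
        exact add_le_add le_rfl (mul_le_mul_of_nonneg_right hu' (norm_nonneg _))
    _ = ‖u - u'‖ * ‖D‖ + ‖D - D'‖ := by ring

variable [NormOneClass E]

/-- ★★★ **BOND LIPSCHITZ ROW OF THE `P₃` PIECE**: `‖bch(uBu*, Y) − bch(u′Bu′*, Y′)‖ ≤ 8·m_Y·β·‖u − u′‖ + 4·β·‖Y − Y′‖`
for `‖u‖,‖u′‖ ≤ 1`, `‖B‖ ≤ β ≤ 1∕40`, `‖Y‖,‖Y′‖ ≤ m_Y ≤ 1∕40`. [cite: Balaban1985Averaging, (19)-(21) p.21] -/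
theorem norm_bchPiece_sub_le {u u' B Y Y' : E} {β mY : ℝ} (hu : ‖u‖ ≤ 1) (hu' : ‖u'‖ ≤ 1) (hB : ‖B‖ ≤ β) (hβ : β ≤ 1 / 40)
    (hY : ‖Y‖ ≤ mY) (hY' : ‖Y'‖ ≤ mY) (hmY : mY ≤ 1 / 40) :
    ‖(mlog (exp (u * B * star u) * exp Y) - u * B * star u - Y) - (mlog (exp (u' * B * star u') * exp Y') - u' * B * star u' - Y')‖
      ≤ 8 * mY * β * ‖u - u'‖ + 4 * β * ‖Y - Y'‖ := by
  have hX : ‖u * B * star u‖ ≤ β := (norm_conj_le' hu B).trans hB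
  have hX' : ‖u' * B * star u'‖ ≤ β := (norm_conj_le' hu' B).trans hB
  have h := norm_bch_sub_bch_le_of_norm_le hX hX' hY hY' hβ hmY
  have hκ : ‖u * B * star u - u' * B * star u'‖ ≤ 2 * ‖u - u'‖ * β := by
    have h1 := norm_conjCoeff_sub_le hu hu' B
    rw [sub_sub_sub_cancel_right] at h1
    exact h1.trans (mul_le_mul_of_nonneg_left hB (by positivity))
  have hmY0 : 0 ≤ mY := (norm_nonneg _).trans hY
  have hβ0 : 0 ≤ β := (norm_nonneg _).trans hB
  calc _ ≤ 4 * mY * ‖u * B * star u - u' * B * star u'‖ + 4 * β * ‖Y - Y'‖ := h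
    _ ≤ 4 * mY * (2 * ‖u - u'‖ * β) + 4 * β * ‖Y - Y'‖ := by
        have := mul_le_mul_of_nonneg_left hκ (by positivity : (0 : ℝ) ≤ 4 * mY); linarith
    _ = 8 * mY * β * ‖u - u'‖ + 4 * β * ‖Y - Y'‖ := by ring

end Summit.QuantumFields.YangMills.Theorems.Prop7BCHPieceRows

end
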